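import Literature.AlgebraicGeometry.AbelianVarieties.HomogeneousLineBundleFieldChange
import Literature.AlgebraicGeometry.AbelianVarieties.HomogeneousLineBundleDivisor
import Literature.AlgebraicGeometry.Motives.CartierDivisorPullbackLineBundleIso
import Literature.AlgebraicGeometry.Motives.AbelianVarietyDegree
import Literature.AlgebraicGeometry.Motives.AbelianVarietyWeilDivisor
import Literature.AlgebraicGeometry.Motives.AbelianVarietyTheoremOfCube
import Literature.AlgebraicGeometry.Motives.AbelianVarietyWeilPairingPullback
import Literature.AlgebraicGeometry.Motives.AbelianVarietyWeilPairingAlgClosure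
import HarnessLib

/-!
# The translation-invariance clause «`t_P^* D ∼ D` for all rational points `P`» ([MumfordAV1970] §8: `𝒪(D) ∈ Pic⁰`)
# transports along isomorphisms, linear equivalence, and — in both directions — along maps of algebraically closed fields

Layer `Literature/AlgebraicGeometry/AbelianVarieties`, namespace `Literature.AlgebraicGeometry.AbelianVarieties.AbelianVariety`.
Cell hodgecm-mathlib, F-DAG leaf F-7 (7b) «triples are rigid», layer (L3) brick F3 (seat B-p03 (g17)): the DIVISOR-FORM reading of
the ★ engine `HomogeneousLineBundleFieldChange` (B-typ03 (g12): `isHomogeneous_descent_along` / `IsHomogeneous.pullbackFst`,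
[MumfordAV1970] §8 (i)⇔(iv)) through the ★ dictionary `isHomogeneous_lineBundle_iff_forall_linEquiv` (`𝒪(D)` homogeneous ⟺
`t_P^*D ∼ D ∀ P`) and ★ `CartierDivisor.pullbackLineBundleIso` (`π^*𝒪(D) ≅ 𝒪(π^*D)`).  This is the shape in which the field
brick of the lemma of Serre (★ `HodgeTheory.AbelianVariety.iso_hom_eq_id_of_linEquiv_translation_of_forall_torsion`, ★
`AbelianSchemes.PolarizedTripleRigidityOfFibre`) carries the polarisation: `D = Θ − e^*Θ`.

* `forall_linEquiv_translation_pullback_iso` — along an isomorphism `e : B′ ≅ B` of abelian varieties: the clause for `D` on `B`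
  gives the clause for `e^*D` on `B′` (`t_{P′} ≫ e = e ≫ t_{e P′}`, ★ `translation_left_comp_toSchemeHom`);
* `forall_linEquiv_translation_of_linEquiv` — along a linear equivalence `D ∼ D′`;
* `forall_linEquiv_translation_descent_along` — DOWN any field map `σ : k → Ω`: the clause for
  `π^*D₁` on `B₁ ⊗_σ Ω` (ALL `Ω`-points) gives the clause for `D₁` on `B₁` (★ `IsHomogeneous.of_pullback_baseChangeAlongFst`);
* `forall_linEquiv_translation_ascent_along` — UP a map `σ : k → L` from an algebraically closed field: the clause for `D₁` on
  `B₁` gives it for `π^*D₁` on `B₁ ⊗_σ L` at ALL `L`-points (★ `IsHomogeneous.pullbackFst`, Mumford §8 (i)⇒(iv) + the slice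
  computation of `Λ(𝒪(D))`).

Theorems only (no definition, no named fact, no instance, no `sorry`).  HC_CM is proved only modulo the 7 printed citations until
rung 0 closes; nothing here is about HC.

## References
* [MumfordAV1970] D. Mumford, *Abelian Varieties* (1970), §8 (the subgroup `K(L)`, `Pic⁰`; (i) ⇔ (iv), pp. 74–80).
* [Mukai1978] S. Mukai, Semi-homogeneous vector bundles on an abelian variety, J. Math. Kyoto Univ. 18 (1978), Def. 4.4 (p. 253).
-/

set_option autoImplicit false

noncomputable section

universe u

open CategoryTheory CategoryTheory.Limits AlgebraicGeometry

namespace Literature.AlgebraicGeometry.AbelianVarieties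

open Literature.AlgebraicGeometry.Motives Literature.AlgebraicGeometry.Modules

namespace AbelianVariety

/-! ### §1 Along isomorphisms and linear equivalences -/

/-- **The clause `t_P^*D ∼ D ∀ P` transports along an isomorphism of abelian varieties**: for `e : B′ ≅ B` and a Cartier
divisor `D` on `B` with `t_Q^*D ∼ D` for all `Q ∈ B(K)`, the pulled-back divisor `e^*D` on `B′` has `t_{P}^*(e^*D) ∼ e^*D` for all
`P ∈ B′(K)` — since `t_P ≫ e = e ≫ t_{e(P)}` (★ `translation_left_comp_toSchemeHom`). [cite: MumfordAV1970, §8 (pp. 74–75)]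
[cite: Mukai1978, Def. 4.4 (p. 253)] -/
theorem forall_linEquiv_translation_pullback_iso {K : Type u} [Field K] {B' B : AbelianVariety K} (e : B' ≅ B)
    (D : CartierDivisor B.X.left) (h : ∀ Q : B.Points K, (D.pullback (B.translation Q).left).LinEquiv D) :
    haveI := AbelianVariety.isDominant_toSchemeHom_iso_hom e
    ∀ P : B'.Points K, ((D.pullback (AbelianVariety.Hom.toSchemeHom e.hom)).pullback (B'.translation P).left).LinEquiv
      (D.pullback (AbelianVariety.Hom.toSchemeHom e.hom)) := by
  haveI := AbelianVariety.isDominant_toSchemeHom_iso_hom e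
  intro P
  set g := AbelianVariety.Hom.toSchemeHom e.hom with hg
  set Q : B.Points K := AlgPoints.map e.hom.hom.hom.hom P with hQ
  have hcomm : (B'.translation P).left ≫ g = g ≫ (B.translation Q).left :=
    AbelianVariety.translation_left_comp_toSchemeHom e.hom P
  haveI : IsDominant ((B'.translation P).left ≫ g) := inferInstance
  haveI : IsDominant (g ≫ (B.translation Q).left) := inferInstance
  -- `t_P^*(e^*D) = (t_P ≫ e)^*D = (e ≫ t_Q)^*D = e^*(t_Q^*D) ∼ e^*D`
  have h1 : ((D.pullback g).pullback (B'.translation P).left).SameDivisor (D.pullback ((B'.translation P).left ≫ g)) :=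
    CartierDivisor.pullback_pullback_sameDivisor D g (B'.translation P).left
  have h2 : (D.pullback ((B'.translation P).left ≫ g)).SameDivisor (D.pullback (g ≫ (B.translation Q).left)) :=
    CartierDivisor.pullback_congr_sameDivisor D hcomm
  have h3 : (D.pullback (g ≫ (B.translation Q).left)).SameDivisor ((D.pullback (B.translation Q).left).pullback g) :=
    (CartierDivisor.pullback_pullback_sameDivisor D (B.translation Q).left g).symm
  exact ((h1.trans h2).trans h3).linEquiv.trans ((h Q).pullback g)

/-- **The clause `t_P^*D ∼ D ∀ P` depends only on the linear equivalence class of `D`.** [cite: MumfordAV1970, §8 (pp. 74–75)] -/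
theorem forall_linEquiv_translation_of_linEquiv {K : Type u} [Field K] {B : AbelianVariety K} {D D' : CartierDivisor B.X.left}
    (hDD' : D.LinEquiv D') (h : ∀ Q : B.Points K, (D.pullback (B.translation Q).left).LinEquiv D) :
    ∀ Q : B.Points K, (D'.pullback (B.translation Q).left).LinEquiv D' :=
  fun Q => ((hDD'.symm.pullback (B.translation Q).left).trans (h Q)).trans hDD'

/-! ### §2 Down and up along maps of algebraically closed fields -/

section FieldChange

variable {k : Type u} [Field k] [IsAlgClosed k] (B₁ : AbelianVariety k) (D₁ : CartierDivisor B₁.X.left)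

omit [IsAlgClosed k] in
/-- **DESCENT: the clause at all `Ω`-points of `B₁ ⊗_σ Ω` for `π^*D₁` gives the clause at all `k`-points of `B₁` for `D₁`**
(`σ : k → Ω` ANY field map, `π : B₁ ⊗_σ Ω → B₁` the projection — passed as a variable with its defining
equation, the convention of ★ `HomogeneousLineBundleFieldChange`; ★ `IsHomogeneous.of_pullback_baseChangeAlongFst` =
`Pic(B₁) ↪ Pic(B₁ ⊗ Ω)` read in divisor form through ★ `pullbackLineBundleIso`). [cite: MumfordAV1970, §8 ((i) ⇔ (iv), pp. 74–80)]
[cite: Mukai1978, Def. 4.4 (p. 253)] -/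
theorem forall_linEquiv_translation_descent_along {Ω : Type u} [Field Ω] (σ : k →+* Ω)
    (π : (B₁.baseChangeAlong σ).X.left ⟶ B₁.X.left) (hπ : π = baseChangeHomFst σ B₁.X) [IsDominant π]
    (h : ∀ P : (B₁.baseChangeAlong σ).Points Ω,
      ((D₁.pullback π).pullback ((B₁.baseChangeAlong σ).translation P).left).LinEquiv (D₁.pullback π)) :
    ∀ P₁ : B₁.Points k, (D₁.pullback (B₁.translation P₁).left).LinEquiv D₁ := by
  rw [← isHomogeneous_lineBundle_iff_forall_linEquiv]
  refine IsHomogeneous.of_pullback_baseChangeAlongFst σ B₁ π hπ D₁.toUnitCocycle.hasRank_lineBundle ?_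
  rw [isHomogeneous_iff_of_iso _ (D₁.pullbackLineBundleIso π), isHomogeneous_lineBundle_iff_forall_linEquiv]
  exact h

/-- **ASCENT: the clause at all `k`-points of `B₁` for `D₁`, `k` ALGEBRAICALLY CLOSED, gives the clause at ALL `L`-points of
`B₁ ⊗_σ L` for `π^*D₁`** (`σ : k → L` any field map; ★ `IsHomogeneous.pullback_baseChangeAlongFst` = [MumfordAV1970] §8 (i)⇒(iv)
`K(D₁) = B₁(k) ⇒ [Λ(𝒪(D₁))] = 1` plus the slice of `Λ` at an `L`-point). [cite: MumfordAV1970, §8 ((i) ⇔ (iv), pp. 74–80)]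
[cite: Mukai1978, Def. 4.4 (p. 253)] -/
theorem forall_linEquiv_translation_ascent_along {L : Type u} [Field L] (σ : k →+* L)
    (π : (B₁.baseChangeAlong σ).X.left ⟶ B₁.X.left) (hπ : π = baseChangeHomFst σ B₁.X) [IsDominant π]
    (h : ∀ P₁ : B₁.Points k, (D₁.pullback (B₁.translation P₁).left).LinEquiv D₁) :
    ∀ P : (B₁.baseChangeAlong σ).Points L,
      ((D₁.pullback π).pullback ((B₁.baseChangeAlong σ).translation P).left).LinEquiv (D₁.pullback π) := by
  rw [← isHomogeneous_lineBundle_iff_forall_linEquiv, ← isHomogeneous_iff_of_iso _ (D₁.pullbackLineBundleIso π)]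
  refine IsHomogeneous.pullback_baseChangeAlongFst σ B₁ π hπ D₁.toUnitCocycle.hasRank_lineBundle ?_
  rw [isHomogeneous_lineBundle_iff_forall_linEquiv]
  exact h

omit [IsAlgClosed k] in
/-- The base-change projection `π = baseChangeHomFst σ B₁.X : B₁ ⊗_σ L → B₁` is dominant (★ `isDominant_baseChangeHomFst_along`;
supplies the instance binder of the two transfer theorems). [cite: MumfordAV1970, §8 (pp. 74–75)] -/
theorem isDominant_of_eq_baseChangeHomFst {L : Type u} [Field L] (σ : k →+* L)
    (π : (B₁.baseChangeAlong σ).X.left ⟶ B₁.X.left) (hπ : π = baseChangeHomFst σ B₁.X) : IsDominant π := by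
  rw [hπ]
  exact AbelianVariety.isDominant_baseChangeHomFst_along σ B₁

end FieldChange

end AbelianVariety

end Literature.AlgebraicGeometry.AbelianVarieties

end
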